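import Summits.QuantumFields.YangMills.Theses.RenyiTelescope
import Summits.QuantumFields.YangMills.Theorems.SmallFieldWideningLargeFieldMassRefinementTailOfTailRoutes
import Literature.MathematicalPhysics.QuantumFieldTheory.Balaban1983to89.T3MinimiserStabilityReduction

/-!
# Route `RenyiTelescope` — glue item `HistoryTailOfRenyiTelescope` (stmt-QuantumFields-27139): THE PLAQUETTE-EVENT TRANSPORT
# (support file; ideator seat `ym-r3-idea-2` g3, registered stub `stub_plaquetteTransport` of the glue skeleton)

THE STEP (G1/L2 of the glue plan attached to the item).  The finest-bad-level pieces of the complement of Bałaban's UV-small-history event of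
run `K = J + d` of a family `F` at coupling `γ`, taken at the `c`-SCALED profile `θ_c = θBal L γ (c·b₀) p₀` —
`{¬PlaqSmall θ_c(d) (Ū^{J})} ∩ {∀ i < J, PlaqSmall θ_c(J + d − i) (Ū^{i})}` (level `J`, height `d`, all finer levels `c`-small) — are, read on
the REFINED family `F.refine d` at coupling `γL^{-d}` (same finest lattice, same Wilson weight, block averagings matched level by level:
`T3ThresholdRemoval.integral_gibbsMeasure_comp_fieldShift`, `T3Family.refine_β`, `T3LevelShift.iter_fieldShift`), sub-events of the union over
the refined family's UNIT plaquettes `p` of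
`(unitA (F.refine d) J)⁻¹{θ'_c(0) ≤ |V(∂p) − 1|} ∩ histGoodInt (F.refine d) θ'_{b₀} (θ'_c 1) J 1`
(`θ' = θ(· + d)` by `θBal_mul_pow`; `c`-small ⇒ `b₀`-small for `c ≤ 1`, and the finest conditioning level `i = J − 1` is the refined family's
height `1`, which is the `c`-window of `histGoodInt`) — EXACTLY the events on which the cruxes `CutoffRenyiL` (stmt-QuantumFields-27137, with
`A := {θ'_c(0) ≤ |V(∂p) − 1|}`) and `FineRegimeUnitTailL` (stmt-QuantumFields-27138) are stated.  Hence (`stub_plaquetteTransport`)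
`Gibbs^{F,γ}_{J+d}(piece) ≤ Σ_p Gibbs^{F.refine d, γL^{-d}}_J((unitA)⁻¹{…} ∩ Int_J)`, for `0 < γ ≤ 1`, `0 < b₀`, `c ≤ 1`, `1 ≤ J`.

§1 `gibbsK_real_eq_refine`: the Gibbs mass of ANY measurable event of run `J + d` of `F` is the Gibbs mass of its `fieldShift`-preimage under
run `J` of `F.refine d` (the event-free form of the landed `LargeFieldMassRefinementTailOfHeightTail.gibbsK_refine_real_compl_histGood`).
§2 `plaqShift_plaqShift` (coherence of the plaquette identifications) and the inclusion `fieldShift_preimage_finestBad_subset`.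
§3 the registered stub, by the union bound over the level-`J` plaquettes (`LargeFieldMassRefinementTailOfTailRoutes.real_not_plaqSmall_inter_le_sum`),
§1, §2 and the reindexing `Plaq (F.P (J+d)) J ≃ Plaq ((F.refine d).P 0) 0` (`plaqShift`).

WHAT THIS IS NOT: no estimate of any Gibbs probability is proved here (pure transport/bookkeeping); the cruxes 27137/27138 and the rest of the
glue (telescope instantiation, base, interior mass) are untouched; nothing here bears on the Yang–Mills mass gap, and the rung R3 (`YM3TorusSU2`)
is NOT proved.

References: T. Bałaban, CMP 102 (1985) 255–275 [Balaban1985UV3] ((1)–(3) p.256: the refined family is the same lattice theory; (7) p.257: the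
decomposition of unity by the first large scale); T. Bałaban, CMP 109 (1987) 249–301 [Balaban1987RG1] ((0.4)/(0.11) p.253: iterated averaging).
-/

noncomputable section

open MeasureTheory
open Literature.MathematicalPhysics.QuantumFieldTheory.Balaban1983to89
open Literature.MathematicalPhysics.QuantumFieldTheory.Balaban1983to89.T3ContinuumYM3Torus
open Literature.MathematicalPhysics.QuantumFieldTheory.Balaban1983to89.T3UnitScaleTilt
open Literature.MathematicalPhysics.QuantumFieldTheory.Balaban1983to89.T3UnitLawDensityEML
open Literature.MathematicalPhysics.QuantumFieldTheory.Balaban1983to89.T3LevelShift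
open Literature.MathematicalPhysics.QuantumFieldTheory.Balaban1983to89.T3ThresholdRemoval
open Literature.MathematicalPhysics.QuantumFieldTheory.Balaban1983to89.T3InteriorExcision
open Literature.MathematicalPhysics.QuantumFieldTheory.Balaban1983to89.T3MinimiserStabilityReduction
open Summit.QuantumFields.YangMills.Theorems.LargeFieldMassRefinementTailOfHeightTail
open Summit.QuantumFields.YangMills.Theorems.LargeFieldMassRefinementTailOfTailRoutes

namespace Summit.QuantumFields.YangMills.Theorems.RenyiTelescope

/-! ## §1 Any event: run `J + d` of `F` is run `J` of `F.refine d` -/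

section AnyEvent

variable (F : T3Family) {G : Type*} [GaugeGroup G] [MeasurableSpace G] [HaarData G] [RegularGaugeGroup G] (ℰ : LoopAverage G)

/-- **THE MASS IDENTIFICATION FOR AN ARBITRARY MEASURABLE EVENT**: `Gibbs^{F,γ}_{J+d}(S) = Gibbs^{F.refine d, γL^{-d}}_J(fieldShift⁻¹ S)` — same
finest lattice (`sitesPerDir_refine_zero`), same Wilson weight (`refine_β`), product Haar measures corresponding under `fieldShift`.
[cite: Balaban1985UV3, (1)-(3) p.256] -/
theorem gibbsK_real_eq_refine {γ : ℝ} (hγ : 0 ≤ γ) (d J : ℕ) {S : Set (GaugeField (F.P (J + d)) 0 G)}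
    (hS : MeasurableSet S) :
    (gibbsK F ℰ γ (J + d)).real S =
      (gibbsK (F.refine d) ℰ (γ * ((F.L : ℝ)⁻¹) ^ d) J).real (fieldShift (sitesPerDir_refine_zero F d J) ⁻¹' S) := by
  have hβ : ((F.refine d).scheme ℰ (γ * ((F.L : ℝ)⁻¹) ^ d)).β J = (F.scheme ℰ γ).β (J + d) := F.refine_β ℰ γ d J
  have hβ0 : 0 ≤ (F.scheme ℰ γ).β (J + d) := F.scheme_β_nonneg ℰ hγ (J + d)
  have hS' : MeasurableSet (fieldShift (G := G) (sitesPerDir_refine_zero F d J) ⁻¹' S) := measurable_fieldShift _ hS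
  have key := integral_gibbsMeasure_comp_fieldShift (G := G) (sitesPerDir_refine_zero F d J) hβ0 (S.indicator 1)
  have hind : (fun V : GaugeField ((F.refine d).P J) 0 G =>
      S.indicator (1 : GaugeField (F.P (J + d)) 0 G → ℝ) (fieldShift (sitesPerDir_refine_zero F d J) V)) =
      (fieldShift (G := G) (sitesPerDir_refine_zero F d J) ⁻¹' S).indicator 1 := by
    funext V
    by_cases hV : fieldShift (sitesPerDir_refine_zero F d J) V ∈ S
    · erw [Set.indicator_of_mem hV]
    · erw [Set.indicator_of_notMem hV]
  erw [hind, integral_indicator_one hS', integral_indicator_one hS] at key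
  rw [gibbsK_eq, gibbsK_eq, hβ]
  exact key.symm

end AnyEvent

/-! ## §2 The plaquette identifications compose; the event inclusion -/

section Inclusion

variable {F : T3Family} {G : Type*} [GaugeGroup G]

/-- Coherence: `plaqShift h' ∘ plaqShift h = plaqShift (h.trans h')`. [cite: Balaban1987RG1, (0.1) p.251] -/
theorem plaqShift_plaqShift {m K j m' K' j' m'' K'' j'' : ℕ} (h : (F.PP m K).sitesPerDir j = (F.PP m' K').sitesPerDir j')
    (h' : (F.PP m' K').sitesPerDir j' = (F.PP m'' K'').sitesPerDir j'') (p : Plaq (F.PP m K) j) :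
    plaqShift h' (plaqShift h p) = plaqShift (h.trans h') p := by
  simp only [plaqShift, Equiv.coe_fn_mk, siteShift_siteShift]

variable (F)

/-- Level `J` of run `J + d` of `F` and the unit lattice of `F.refine d` have the same modulus `2L^{m+d}`. [cite: Balaban1985UV3, (1)-(3) p.256] -/
theorem sitesPerDir_level_refine_unit (d J : ℕ) : (F.PP F.m (J + d)).sitesPerDir J = (F.PP (F.m + d) 0).sitesPerDir 0 :=
  F.sitesPerDir_eq (by omega)

/-- Bałaban's thresholds are monotone in the profile constant: `θBal L γ (c·b₀) p₀ i ≤ θBal L γ b₀ p₀ i` for `c ≤ 1` (`0 < γ ≤ 1`, `0 < b₀`,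
`1 ≤ L`). [cite: Balaban1985UV3, (7) p.257] -/
theorem θBal_scaled_le {L : ℕ} (hL : 1 ≤ L) {γ b₀ c : ℝ} (hγ : 0 < γ) (hγ1 : γ ≤ 1) (hb₀ : 0 < b₀) (hc1 : c ≤ 1) (p₀ : ℝ) (i : ℕ) :
    θBal L γ (c * b₀) p₀ i ≤ θBal L γ b₀ p₀ i := by
  rw [θBal_mul]
  exact mul_le_of_le_one_left (θBal_pos hL hγ hγ1 hb₀ p₀ i).le hc1

/-- `PlaqSmall` is monotone in the threshold. [cite: Balaban1987RG1, (0.18) p.255] -/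
theorem plaqSmall_of_le {P : Params} {j : ℕ} {δ δ' : ℝ} (h : δ ≤ δ') {U : GaugeField P j G} (hU : PlaqSmall δ U) :
    PlaqSmall δ' U :=
  fun p => (hU p).trans_le h

/-- **THE EVENT INCLUSION**: read through `fieldShift` on run `J` of `F.refine d`, the finest-bad-level piece at level `J` (height `d`) of run
`J + d` of `F` at the profile `θ_c = θBal L γ (c b₀) p₀`, restricted to the level-`J` plaquette `a`, lies in the unit-plaquette event of
`plaqShift a` intersected with the interior event `histGoodInt (F.refine d) θ'_{b₀} (θ'_c 1) J 1` (`θ' = θ(· + d)`; `c ≤ 1`, `1 ≤ J`).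
[cite: Balaban1985UV3, (7) p.257] -/
theorem fieldShift_preimage_finestBad_subset {γ b₀ c : ℝ} (p₀ : ℝ) (hγ : 0 < γ) (hγ1 : γ ≤ 1) (hb₀ : 0 < b₀) (hc1 : c ≤ 1)
    {d J : ℕ} (hJ : 1 ≤ J) (a : Plaq (F.P (J + d)) J) :
    fieldShift (G := Matrix.specialUnitaryGroup (Fin 2) ℂ) (sitesPerDir_refine_zero F d J) ⁻¹'
        ({U | θBal F.L γ (c * b₀) p₀ (J + d - J) ≤ GaugeGroup.dist1 (GaugeField.plaqHol
            (Averaging.iter (fun i => BlockAveraging.blockAvg (P := F.P (J + d)) (j := i) ℰp) J U) a)} ∩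
          {U | ∀ i, i < J → PlaqSmall (θBal F.L γ (c * b₀) p₀ (J + d - i))
            (Averaging.iter (fun i' => BlockAveraging.blockAvg (P := F.P (J + d)) (j := i') ℰp) i U)}) ⊆
      (unitA (F.refine d) ℰp J) ⁻¹'
          {V | θBal F.L (γ * ((F.L : ℝ)⁻¹) ^ d) (c * b₀) p₀ 0 ≤
            GaugeGroup.dist1 (GaugeField.plaqHol V (plaqShift (sitesPerDir_level_refine_unit F d J) a))} ∩
        histGoodInt (F.refine d) (θBal F.L (γ * ((F.L : ℝ)⁻¹) ^ d) b₀ p₀)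
          (θBal F.L (γ * ((F.L : ℝ)⁻¹) ^ d) (c * b₀) p₀ 1) J 1 := by
  intro V hV
  obtain ⟨h1, h2⟩ := hV
  simp only [Set.mem_setOf_eq] at h1 h2
  have hmK : F.m + (J + d) = F.m + d + J := by omega
  have hL : 1 ≤ F.L := F.hL.2.le
  refine ⟨?_, ?_, ?_⟩
  · -- the bad unit plaquette
    have key := iter_fieldShift ℰp hmK J V
    erw [key, plaqHol_fieldShift] at h1
    rw [Nat.add_sub_cancel_left] at h1
    show θBal F.L (γ * ((F.L : ℝ)⁻¹) ^ d) (c * b₀) p₀ 0 ≤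
      GaugeGroup.dist1 (GaugeField.plaqHol (fieldShift ((F.refine d).sitesPerDir_unit J)
        (Averaging.iter (fun i => BlockAveraging.blockAvg (P := (F.refine d).P J) (j := i) ℰp) J V))
        (plaqShift (sitesPerDir_level_refine_unit F d J) a))
    erw [plaqHol_fieldShift, plaqShift_plaqShift]
    rw [θBal_mul_pow, Nat.zero_add]
    exact h1
  · -- all finer levels `b₀`-small: the refined family's UV-small history with one free top step
    intro j hj
    have hjJ : j < J := by omega
    have hsmall := h2 j hjJ
    have key := iter_fieldShift ℰp hmK j V
    erw [key, plaqSmall_fieldShift_iff] at hsmall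
    rw [θBal_mul_pow, show J - j + d = J + d - j by omega]
    exact plaqSmall_of_le (θBal_scaled_le hL hγ hγ1 hb₀ hc1 p₀ _) hsmall
  · -- the refined family's height `1` (level `J − 1`) is `c`-small
    have hsmall := h2 (J - 1) (by omega)
    have key := iter_fieldShift ℰp hmK (J - 1) V
    erw [key, plaqSmall_fieldShift_iff] at hsmall
    show PlaqSmall (θBal F.L (γ * ((F.L : ℝ)⁻¹) ^ d) (c * b₀) p₀ 1)
      (Averaging.iter (fun i => BlockAveraging.blockAvg (P := (F.refine d).P J) (j := i) ℰp) (J - 1) V)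
    rw [θBal_mul_pow, show 1 + d = J + d - (J - 1) by omega]
    exact hsmall

end Inclusion

/-! ## §3 The registered stub -/

section Stub

/-- Measurability of the finest-bad-level piece restricted to one plaquette. [cite: Balaban1985UV3, (7) p.257] -/
theorem measurableSet_finestBad_plaq (F : T3Family) (θ : ℕ → ℝ) (K J : ℕ) (a : Plaq (F.P K) J) :
    MeasurableSet ({U : GaugeField (F.P K) 0 (Matrix.specialUnitaryGroup (Fin 2) ℂ) |
        θ (K - J) ≤ GaugeGroup.dist1 (GaugeField.plaqHol
          (Averaging.iter (fun i => BlockAveraging.blockAvg (P := F.P K) (j := i) ℰp) J U) a)} ∩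
      {U | ∀ i, i < J → PlaqSmall (θ (K - i))
        (Averaging.iter (fun i' => BlockAveraging.blockAvg (P := F.P K) (j := i') ℰp) i U)}) := by
  refine MeasurableSet.inter ?_ ?_
  · exact measurableSet_le measurable_const (RegularGaugeGroup.measurable_dist1.comp ((Missing.measurable_plaqHol a).comp
      (T4Continuum.measurable_iter _ (F.avgMeasurable_of_measurableE ℰp measurableE_ℰp K) J)))
  · rw [Set.setOf_forall]
    refine MeasurableSet.iInter fun i => ?_
    by_cases hi : i < J
    · simp only [hi, forall_true_left]
      exact T4Continuum.measurable_iter _ (F.avgMeasurable_of_measurableE ℰp measurableE_ℰp K) i (measurableSet_plaqSmall _)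
    · simp only [hi, IsEmpty.forall_iff, Set.setOf_true, MeasurableSet.univ]

/-- **REGISTERED STUB `stub_plaquetteTransport` OF THE GLUE SKELETON (item stmt-QuantumFields-27139)**: the Gibbs mass (run `J + d` of `F` at
`γ`) of the finest-bad-level piece at level `J` for the `c`-scaled profile is at most the sum over the unit plaquettes `p` of `F.refine d` of the
Gibbs masses (run `J` of `F.refine d` at `γL^{-d}`) of `(unitA)⁻¹{θ'_c(0) ≤ |V(∂p) − 1|} ∩ histGoodInt (F.refine d) θ'_{b₀} (θ'_c 1) J 1` — the events
of the cruxes `CutoffRenyiL` / `FineRegimeUnitTailL`.  Union bound over plaquettes, §1, §2, reindexing by `plaqShift`.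
[cite: Balaban1985UV3, (1)-(3) p.256 and (7) p.257] -/
theorem stub_plaquetteTransport : ∀ (F : T3Family) (γ b₀ c p₀ : ℝ) (d J : ℕ), 0 < γ → γ ≤ 1 → 0 < b₀ → c ≤ 1 → 1 ≤ J →
    (gibbsK F ℰp γ (J + d)).real
        ({U | ¬ PlaqSmall (θBal F.L γ (c * b₀) p₀ (J + d - J))
            (Averaging.iter (fun i => BlockAveraging.blockAvg (P := F.P (J + d)) (j := i) ℰp) J U)} ∩
          {U | ∀ i, i < J → PlaqSmall (θBal F.L γ (c * b₀) p₀ (J + d - i))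
            (Averaging.iter (fun i' => BlockAveraging.blockAvg (P := F.P (J + d)) (j := i') ℰp) i U)}) ≤
      ∑ p : Plaq ((F.refine d).P 0) 0,
        (gibbsK (F.refine d) ℰp (γ * ((F.L : ℝ)⁻¹) ^ d) J).real
          ((unitA (F.refine d) ℰp J) ⁻¹'
              {V | θBal F.L (γ * ((F.L : ℝ)⁻¹) ^ d) (c * b₀) p₀ 0 ≤ GaugeGroup.dist1 (GaugeField.plaqHol V p)} ∩
            histGoodInt (F.refine d) (θBal F.L (γ * ((F.L : ℝ)⁻¹) ^ d) b₀ p₀)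
              (θBal F.L (γ * ((F.L : ℝ)⁻¹) ^ d) (c * b₀) p₀ 1) J 1) := by
  intro F γ b₀ c p₀ d J hγ hγ1 hb₀ hc1 hJ
  haveI := isProbabilityMeasure_gibbsK F ℰp hγ.le (J + d)
  have hγ' : 0 ≤ γ * ((F.L : ℝ)⁻¹) ^ d := mul_nonneg hγ.le (pow_nonneg (inv_nonneg.mpr (Nat.cast_nonneg _)) _)
  haveI := isProbabilityMeasure_gibbsK (F.refine d) ℰp hγ' J
  -- union bound over the level-`J` plaquettes of run `J + d`
  refine (real_not_plaqSmall_inter_le_sum (gibbsK F ℰp γ (J + d))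
    (fun U => Averaging.iter (fun i => BlockAveraging.blockAvg (P := F.P (J + d)) (j := i) ℰp) J U)
    (θBal F.L γ (c * b₀) p₀ (J + d - J)) _).trans ?_
  -- reindex the right-hand sum by the level-`J` plaquettes
  refine le_of_le_of_eq (Finset.sum_le_sum fun a _ => ?_)
    (Fintype.sum_equiv (plaqShift (sitesPerDir_level_refine_unit F d J) : Plaq (F.P (J + d)) J ≃ Plaq ((F.refine d).P 0) 0)
      _ _ (fun _ => rfl))
  -- transport the `a`-th piece and use the inclusion
  have hS := measurableSet_finestBad_plaq F (θBal F.L γ (c * b₀) p₀) (J + d) J a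
  rw [gibbsK_real_eq_refine F ℰp hγ.le d J hS]
  exact measureReal_mono (fieldShift_preimage_finestBad_subset F p₀ hγ hγ1 hb₀ hc1 hJ a) (measure_ne_top _ _)

end Stub

end Summit.QuantumFields.YangMills.Theorems.RenyiTelescope

end
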